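import Summits.HodgeConjecture.HodgeConjecture.Theorems.Ring2AbelianAllAndrePrimitiveLiftRows
import Summits.HodgeConjecture.HodgeConjecture.Theorems.Ring2AbelianAllAndreFibreClassRankOneInvariants
import HarnessLib

/-!
# Ring 2 · sub-cell AbelianAll (ALL ABELIAN VARIETIES), André axis, part XXI-e — RANK-ONE INVARIANTS IN DEGREE FOUR MAKE
# (Prim)_t(2) VACUOUS; on compact pencils of abelian SIXFOLDS with `dim Im j_t^* H⁴ = 1` (the (W_E)₃ habitat with large
# monodromy) the whole André-axis lift at `t` — and (Num_t) in every bidegree at an `E`-power / CM point — is EXACTLY the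
# lift of the `κ`-primitive invariant algebraic classes of the MIDDLE degree `H⁶(X_t)`

HONEST FRAMING (page 1, verbatim): **research route, not a corollary; conditional on HC_CM plus one named
minimal statement.** Cell line: research route conditional on HC_CM; not a corollary; Q11.4-sentence-2
already refuted in dim ≥ 3. Nothing in this file proves a case of the Hodge conjecture for an abelian variety.
`HC_CM` = `Theses.RankFourFaces.CMAbelianHodge` is a BINDER (one theorem); item `Theses.RankFourFaces.CMToAbelian`
(stmt-16267) OPEN and not closed here. Seat `pub-hodge-ring2-ab-andre-2`, gen 13 (sequel of parts XXI-a–d, owed item o38;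
for the Weil seats' (W_E)₃ habitat, cf. part XV-e's rank-one rows for the (β′)/(N₃) nodes).

## Content

* §1 **`primitiveLift_two_of_finrank_range_four_eq_one (hf) (t) (hK) (h1 : finrank (Im j_t^* on H⁴) = 1)`**: (Prim)_t(2)
  holds vacuously — `Im j_t^* = ℂ · κ_t²` (`κ_t² ≠ 0`, part XV-e), a `κ_t`-primitive class in it lies in `L²P⁰ ∩ P⁴ = 0`
  (uniqueness of the Lefschetz decomposition on the carriers); for `d < 4` there are no primitive classes of degree 4.
* §2 `d = 6`: **`forall_comap_le_sup_iff_primitiveLift_three_of_finrank_range_four_eq_one`** (granted `A(X_t, κ)`: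
  `(∀ p, (L)_t(p)) ⟺ (Prim)_t(3)`); **`forall_numerical_iff_primitiveLift_three_of_mem_cmPowerLocus_of_finrank_range_four_eq_one`**
  (at an `E`-power point, NO `HC_CM`, NO named fact: `[(Num_t) every bidegree] ⟺ (Prim)_t(3)`);
  `forall_numerical_iff_primitiveLift_three_of_HC_CM_of_finrank_range_four_eq_one` (at a CM point, `HC_CM` a binder).

READING FOR THE W₆ HABITAT: on a (W_E)₃ pencil `𝒳⁷ → S` whose invariant `(2,2)`-classes at the `E⁶`-point `t` are spanned by
`κ_t²`, the "hom ≡ num" bracket `NumE` of part XIX-f at `t` (all bidegrees) is the statement that every `κ_t`-primitive invariant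
algebraic class of `H⁶(E⁶)` — e.g. the primitive projections of the transported Weil classes — is the restriction of a
codimension-3 cycle of the sevenfold (equivalently, part XXI-d: the fibre-primitive sextic Hodge classes of `𝒳` are algebraic
modulo `ker j_t^*`). Nothing is closed; `(W_E)₃` is an OPEN habitat node (part IX); 'minimal' claimed nowhere.

EDGE LABELS (RING2-MAP §AbelianAll gen 13): §1 K; §2 K[A(X_t,κ)] / K (E-power) / K[HC_CM]. References: VoisinHodgeI2002
(§6.2.3 Cor. 6.26, Thm. 6.25); Kleiman1968AlgebraicCycles (§3); vanGeemen1994HodgeAV (Thm. 4.3); Andre1996Motifs (§6.3);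
Abdulali1994FamiliesAV (p. 1122).
-/

noncomputable section

set_option linter.dupNamespace false

namespace Summit.HodgeConjecture.HodgeConjecture.Ring2.AbelianAll

open CategoryTheory AlgebraicGeometry
open Literature.AlgebraicGeometry Literature.AlgebraicGeometry.Motives
open Literature.AlgebraicGeometry.HodgeTheory
open Literature.AlgebraicTopology.SingularHomology (singularCohomology cupProduct)
open Literature.Geometry.Kaehler (lefschetzOperator lefschetzPow HasHardLefschetzProperty)
open Literature.AlgebraicGeometry.Deligne1982 (cmLocus)
open Summit.HodgeConjecture.HodgeConjecture.Theses
open Summit.HodgeConjecture.HodgeConjecture.Ring2.Hypotheses (cmPowerLocus)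

variable {𝒳 S : SchemeOver ℂ}

/-! ## §1 Rank-one invariants in degree four make (Prim)_t(2) vacuous -/

/-- **If the invariant classes of degree `4` at `t` form a LINE (necessarily `ℂ · κ_t²`), then (Prim)_t(2) holds vacuously**:
a `κ_t`-primitive class in `Im j_t^* = ℂ · κ_t²` lies in the Lefschetz summand `L² P⁰` as well as in `P⁴`, hence vanishes
(uniqueness of the Lefschetz decomposition); for `d < 4` there are no primitive classes of degree `4` at all. (`κ_t² ≠ 0` by
hard Lefschetz, part XV-e `map_fiberι_lefschetzPowTo_one_ne_zero_of_le`.) [cite: VoisinHodgeI2002, §6.2.3 Cor. 6.26 and Thm. 6.25] -/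
theorem primitiveLift_two_of_finrank_range_four_eq_one {d : ℕ} {f : 𝒳 ⟶ S} (hf : IsCompactAbelianPencil f d)
    (t : ComplexPoints S) {K : complexBetti 𝒳 2}
    (hK : ∀ s : ComplexPoints S, HasHardLefschetzProperty (complexBetti.map (fiberι f s) 2 K) d)
    (h1 : Module.finrank ℂ (LinearMap.range (complexBetti.map (fiberι f t) (2 * 2)).hom) = 1) :
    ∀ ξ ∈ algebraicClasses (fiberOver f t) 2,
      ξ ∈ primitiveClasses (complexBetti.map (fiberι f t) 2 K) d (2 * 2) →
      ξ ∈ LinearMap.range (complexBetti.map (fiberι f t) (2 * 2)).hom →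
      ξ ∈ (algebraicClasses 𝒳 2).map (complexBetti.map (fiberι f t) (2 * 2)).hom := by
  intro ξ _ hprim hrange
  suffices h0 : ξ = 0 by rw [h0]; exact Submodule.zero_mem _
  set κ := complexBetti.map (fiberι f t) 2 K with hκdef
  rcases lt_or_ge d (2 * 2) with hd | hd
  · rw [primitiveClasses_eq_bot_of_lt κ d hd, Submodule.mem_bot] at hprim
    exact hprim
  -- the generator `κ_t² = j_t^*(L_K² 1)` of the line `Im j_t^*`
  have h00 : 0 + 2 * 2 = 2 * 2 := by norm_num
  set v := complexBetti.map (fiberι f t) (2 * 2)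
    (lefschetzPowTo K 2 0 (2 * 2) h00 (singularCohomology.one ℂ (ComplexPoints 𝒳))) with hvdef
  have hv0 : v ≠ 0 := map_fiberι_lefschetzPowTo_one_ne_zero_of_le hf hK (by omega) h00 t
  have hvr : v ∈ LinearMap.range (complexBetti.map (fiberι f t) (2 * 2)).hom := ⟨_, rfl⟩
  -- `ξ = c • v`
  obtain ⟨c, hc⟩ : ∃ c : ℂ, c • v = ξ := by
    have hne : (⟨v, hvr⟩ : LinearMap.range (complexBetti.map (fiberι f t) (2 * 2)).hom) ≠ 0 := fun h ↦
      hv0 (congrArg Subtype.val h)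
    obtain ⟨c, hc⟩ := (finrank_eq_one_iff_of_nonzero' _ hne).1 h1 ⟨ξ, hrange⟩
    exact ⟨c, congrArg Subtype.val hc⟩
  -- `v ∈ L² P⁰`: every class of degree `0` is primitive
  have hone : complexBetti.map (fiberι f t) 0 (singularCohomology.one ℂ (ComplexPoints 𝒳)) ∈ primitiveClasses κ d 0 := by
    rw [primitiveClasses_eq_ker κ d (by omega) (show 0 + (d + 1) = d + 1 by omega)
      (show 0 + 2 * (d + 1) = 2 * d + 2 by ring), LinearMap.mem_ker]
    haveI := hvan_fiberOver hf t (2 * d + 2) (by omega)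
    exact Subsingleton.elim _ _
  have hvmem : v ∈ lefschetzSummand κ d (2 * 2) ⟨(0, 2), h00⟩ := by
    rw [hvdef, map_fiberι_lefschetzPowTo t K 2 0 (2 * 2) h00]
    exact lefschetzPowTo_mem_lefschetzSummand h00 hone
  have hξmem : ξ ∈ lefschetzSummand κ d (2 * 2) ⟨(0, 2), h00⟩ := by
    rw [← hc]; exact Submodule.smul_mem _ c hvmem
  -- uniqueness of the Lefschetz decomposition: the `(4,0)`-part of `ξ` is `ξ` and `0`
  have h40 : 2 * 2 + 2 * 0 = 2 * 2 := by norm_num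
  have hne : (⟨(0, 2), h00⟩ : {P : ℕ × ℕ // P.1 + 2 * P.2 = 2 * 2}) ≠ ⟨(2 * 2, 0), h40⟩ := by
    intro h; have := congrArg (fun P ↦ P.1.2) h; simp at this
  have hzero := primitivePart_eq_zero_of_mem_ne (hK t) (hvan_fiberOver hf t) hne hξmem
  have hself := primitivePart_lefschetzPowTo_of_mem (hK t) (hvan_fiberOver hf t) ⟨(2 * 2, 0), h40⟩
    (show 2 * 2 + 0 ≤ d by omega) hprim
  rw [lefschetzPowTo_zero_eq_id κ, LinearMap.id_apply] at hself
  rw [← hself]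
  exact hzero

/-! ## §2 Consequences for compact pencils of abelian SIXFOLDS with rank-one invariants in degree four (the W₆ habitat) -/

/-- **`d = 6`, rank-one `H⁴`-invariants at `t`: the lift in EVERY degree ⟺ (Prim)_t(3) alone**, granted the surjectivity clause
of `A(X_t, κ)` in codimension `2` (free at fibres satisfying HC — `E`-power or CM under `HC_CM` — and modulo Lieberman at every
fibre, parts XXI-b/c). [cite: Kleiman1968AlgebraicCycles, §3] [cite: VoisinHodgeI2002, §6.2.3 Cor. 6.26] -/
theorem forall_comap_le_sup_iff_primitiveLift_three_of_finrank_range_four_eq_one {f : 𝒳 ⟶ S}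
    (hf : IsCompactAbelianPencil f 6) (t : ComplexPoints S) {K : complexBetti 𝒳 2} (hKalg : K ∈ algebraicClasses 𝒳 1)
    (hK : ∀ s : ComplexPoints S, HasHardLefschetzProperty (complexBetti.map (fiberι f s) 2 K) 6)
    (hKt : IsPolarizationClass 6 (fiberOver f t) (complexBetti.map (fiberι f t) 2 K))
    (hAt : StandardConjectureA 6 (fiberOver f t) (complexBetti.map (fiberι f t) 2 K))
    (h1 : Module.finrank ℂ (LinearMap.range (complexBetti.map (fiberι f t) (2 * 2)).hom) = 1) :
    (∀ p : ℕ, (algebraicClasses (fiberOver f t) p).comap (complexBetti.map (fiberι f t) (2 * p)).hom ≤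
      algebraicClasses 𝒳 p ⊔ LinearMap.ker (complexBetti.map (fiberι f t) (2 * p)).hom) ↔
    ∀ ξ ∈ algebraicClasses (fiberOver f t) 3,
      ξ ∈ primitiveClasses (complexBetti.map (fiberι f t) 2 K) 6 (2 * 3) →
      ξ ∈ LinearMap.range (complexBetti.map (fiberι f t) (2 * 3)).hom →
      ξ ∈ (algebraicClasses 𝒳 3).map (complexBetti.map (fiberι f t) (2 * 3)).hom := by
  rw [forall_comap_le_sup_iff_primitiveLift_of_standardConjectureA hf t hKalg hK hKt hAt]
  refine ⟨fun h ↦ h 3 (by omega) (by omega), fun h r h2 h2d ↦ ?_⟩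
  rcases Nat.lt_or_ge r 3 with hr | hr
  · obtain rfl : r = 2 := by omega
    exact primitiveLift_two_of_finrank_range_four_eq_one hf t hK h1
  · obtain rfl : r = 3 := by omega
    exact h

/-- **`d = 6` at an `E`-power point with rank-one `H⁴`-invariants (the (W_E)₃ habitat; NO `HC_CM`, NO named fact): (Num_t) in
EVERY bidegree ⟺ (Prim)_t(3)** — the W₆ bracket of parts XIX-f / XXI-b at that point is EXACTLY the lift of the
`κ`-primitive invariant algebraic classes of the MIDDLE degree `H⁶(E⁶)` (e.g. the primitive projections of the transported Weil
classes). [cite: Kleiman1968AlgebraicCycles, §3 (D(X))] [cite: vanGeemen1994HodgeAV, Thm. 4.3] -/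
theorem forall_numerical_iff_primitiveLift_three_of_mem_cmPowerLocus_of_finrank_range_four_eq_one {f : 𝒳 ⟶ S}
    (hf : IsCompactAbelianPencil f 6) {t : ComplexPoints S} (ht : t ∈ cmPowerLocus f 6) {K : complexBetti 𝒳 2}
    (hKalg : K ∈ algebraicClasses 𝒳 1)
    (hKs : ∀ s : ComplexPoints S, IsPolarizationClass 6 (fiberOver f s) (complexBetti.map (fiberι f s) 2 K))
    (h1 : Module.finrank ℂ (LinearMap.range (complexBetti.map (fiberι f t) (2 * 2)).hom) = 1) :
    (∀ (p q : ℕ) (hpq : p + q = 6), ∀ b ∈ algebraicClasses (fiberOver f t) q,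
      (∀ a ∈ algebraicClasses 𝒳 p,
        cupProduct (show 2 * p + 2 * (q + 1) = 2 * (6 + 1) by omega) a (fiberGysin hf t q b) = 0) →
        fiberGysin hf t q b = 0) ↔
    ∀ ξ ∈ algebraicClasses (fiberOver f t) 3,
      ξ ∈ primitiveClasses (complexBetti.map (fiberι f t) 2 K) 6 (2 * 3) →
      ξ ∈ LinearMap.range (complexBetti.map (fiberι f t) (2 * 3)).hom →
      ξ ∈ (algebraicClasses 𝒳 3).map (complexBetti.map (fiberι f t) (2 * 3)).hom := by
  have hHC := hodgeConjectureFor_fiberOver_of_mem_cmPowerLocus ht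
  rw [forall_numerical_iff_primitiveLift_of_hodge hf t hKalg (fun s ↦ (hKs s).hasHardLefschetz) (hKs t)
    (fun p c hc hpp ↦ hHC.2 p c hc hpp)]
  refine ⟨fun h ↦ h 3 (by omega) (by omega), fun h r h2 h2d ↦ ?_⟩
  rcases Nat.lt_or_ge r 3 with hr | hr
  · obtain rfl : r = 2 := by omega
    exact primitiveLift_two_of_finrank_range_four_eq_one hf t (fun s ↦ (hKs s).hasHardLefschetz) h1
  · obtain rfl : r = 3 := by omega
    exact h

/-- **The same at a CM point under `HC_CM` (a BINDER)**: on a compact pencil of abelian sixfolds with rank-one `H⁴`-invariants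
at its CM point, (Num_t) in every bidegree ⟺ (Prim)_t(3). [cite: Andre1996Motifs, §6.3 a) (p. 33)] [cite: Kleiman1968AlgebraicCycles, §3] -/
theorem forall_numerical_iff_primitiveLift_three_of_HC_CM_of_finrank_range_four_eq_one (hCM : RankFourFaces.CMAbelianHodge)
    {f : 𝒳 ⟶ S} (hf : IsCompactAbelianPencil f 6) {t : ComplexPoints S} (ht : t ∈ cmLocus f 6) {K : complexBetti 𝒳 2}
    (hKalg : K ∈ algebraicClasses 𝒳 1)
    (hKs : ∀ s : ComplexPoints S, IsPolarizationClass 6 (fiberOver f s) (complexBetti.map (fiberι f s) 2 K))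
    (h1 : Module.finrank ℂ (LinearMap.range (complexBetti.map (fiberι f t) (2 * 2)).hom) = 1) :
    (∀ (p q : ℕ) (hpq : p + q = 6), ∀ b ∈ algebraicClasses (fiberOver f t) q,
      (∀ a ∈ algebraicClasses 𝒳 p,
        cupProduct (show 2 * p + 2 * (q + 1) = 2 * (6 + 1) by omega) a (fiberGysin hf t q b) = 0) →
        fiberGysin hf t q b = 0) ↔
    ∀ ξ ∈ algebraicClasses (fiberOver f t) 3,
      ξ ∈ primitiveClasses (complexBetti.map (fiberι f t) 2 K) 6 (2 * 3) →
      ξ ∈ LinearMap.range (complexBetti.map (fiberι f t) (2 * 3)).hom →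
      ξ ∈ (algebraicClasses 𝒳 3).map (complexBetti.map (fiberι f t) (2 * 3)).hom := by
  rw [forall_numerical_iff_primitiveLift_of_HC_CM hCM hf ht hKalg (fun s ↦ (hKs s).hasHardLefschetz) (hKs t)]
  refine ⟨fun h ↦ h 3 (by omega) (by omega), fun h r h2 h2d ↦ ?_⟩
  rcases Nat.lt_or_ge r 3 with hr | hr
  · obtain rfl : r = 2 := by omega
    exact primitiveLift_two_of_finrank_range_four_eq_one hf t (fun s ↦ (hKs s).hasHardLefschetz) h1
  · obtain rfl : r = 3 := by omega
    exact h

end Summit.HodgeConjecture.HodgeConjecture.Ring2.AbelianAll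

end
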